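/-
Origin: expansion seat `planner-pub-hodgecm-pv14-g3-0`, handover #4 2026-08-18T05:46:11Z (`HOME/pub-hodgecm-pv14-g3/lean/Pv14g3/PerL34/P43KTypesFockJplus.lean`, md5 221d7b09, 254 lines);
landed by the gen-6 packager in gate run 23 as `HodgeCM/PerL34/P43_KTypesFockJplus.lean` (import ^import Pv14g3\.PerL34\.P43KTypesFock\b→import HodgeCM.PerL34.P43_KTypesFock ×1).
-/
/-
Origin: HOME/pub-hodgecm-pv14-g3/lean/Pv14g3/PerL34/P43KTypesFockJplus.lean — session planner-pub-hodgecm-pv14-g3-0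
(unit pub-hodgecm-pv14-g3, DAG-NODE PROVER #14 gen 3).  Intended final place: `HodgeCM/PerL34/P43_KTypesFockJplus.lean`,
after `P43_KTypesFock.lean` (this seat).  On landing rewrite the import `Pv14g3.PerL34.P43KTypesFock` ↦
`HodgeCM.PerL34.P43_KTypesFock`.  DAG node **N33b** (PerL v5 Prop 4.3 proof, input (X1), tex ll. 646–652).
Nothing cited, nothing asserted.
-/
import Summits.HodgeConjecture.HodgeCM.PerL34.P43_KTypesFock

set_option autoImplicit false

/-!
# N33b (X1), concrete `K_{ι₁}`-types IV: the `J⁺`-piece is a `K`-subrepresentation; `𝔭₊ ↪ J⁺`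

Three consistency statements about pv12's explicit Fock model `Fock.HarmModel = ℂ[z₁,z₂,w]` and the `K = U(2)×U(1)`
group action `fockRep` of `P43_KTypesFock`, all kernel:

* **`jplusSub : Subrepresentation fockRep`** — the `J⁺`-piece `{f | Fock.InJplus f}` (`U(1)_W`-weight one) is
  stable under the WHOLE group `K` (not only under its diagonal torus): `Fock.InJplus f` is weighted homogeneity of
  `uWt`-weight `1` (`inJplus_iff_isWeightedHomogeneous`) and the substitution `(A,d)` maps `z_a`, `w` to weighted
  homogeneous elements of the same `uWt`-weight (`isWeightedHomogeneous_substHom`).  This is the kernel form of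
  "`K_{ι₁} ⊂ U(V)` commutes with `U(W)`", i.e. the `K`-types of `ω` are read off INSIDE the `J⁺`-piece;
  `Jplus : Representation ℂ K _` is the resulting `K`-representation.
* **`noEmbedding_of_Jplus`** — the exclusions of `P43_KTypesFock` in their natural input shape: any `ℂ[K]`-module
  `N` with an injective `ℂ[K]`-linear map into a product of copies of `Jplus.asModule` admits no embedding of
  `F_{0,0}` and none of `F_{1,1}`; `thetaPKilledByPminus_of_U2_Jplus` is the X1 bridge in that shape.
* **`pPlus_embeds_Jplus`** (CONVENTION LOCK) — the abstract `𝔭₊ = (1,0;−1)` of `P43_KTypesU2Gen`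
  (`pPlus (A,d) v = d̄ • A v`) IS a `K`-type of `J⁺` in the model: `v ↦ v₁ z₁ + v₂ z₂` is an injective
  `K`-intertwiner `pPlus → Jplus` onto the harmonic plane (pv12 `jplus_lowest`: the lowest `K`-type, multiplicity
  one).  So the `𝔭₊` in "`Θ[𝔭₊]`, the lowest `K_{ι₁}`-type of `J⁺`" (ll. 646–648) and the `𝔭₊` of the tensor
  identity `𝔭₋ ⊗ 𝔭₊ ≅ F_{0,0} ⊕ F_{1,1}` (`P43_KTypesU2Gen.outerEquiv`) are the same `K`-module — the adversarial
  "two `𝔭₊`'s" question, settled in the kernel for the model PerL specifies (MODEL CAVEAT of `P43_KTypesFock`).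
-/

noncomputable section

namespace HodgeCM
namespace PerL34
namespace P43KTypesU2

open Matrix Complex MvPolynomial P43KTypes P43X1Bridge

/-! ## The `J⁺`-condition as weighted homogeneity -/

/-- (Ported verbatim from the HodgeCMPerL package; no docstring in the source.) -/
theorem wt_uWt_eq (m : Fock.HarmVar →₀ ℕ) :
    Fock.wt Fock.uWt m = (m (Sum.inl 0) : ℤ) + m (Sum.inl 1) - m (Sum.inr ()) := by
  simp only [Fock.wt, Fock.uWt, Fintype.sum_sum_type, Fin.sum_univ_two, Fintype.sum_unique]
  ring

/-- (Ported verbatim from the HodgeCMPerL package; no docstring in the source.) -/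
theorem weight_uWt_eq (m : Fock.HarmVar →₀ ℕ) :
    Finsupp.weight Fock.uWt m = (m (Sum.inl 0) : ℤ) + m (Sum.inl 1) - m (Sum.inr ()) := by
  rw [Finsupp.weight_apply, Finsupp.sum_fintype _ _ (fun _ => by simp)]
  simp only [Fock.uWt, Fintype.sum_sum_type, Fin.sum_univ_two, Fintype.sum_unique]
  ring

/-- `f` lies in the `J⁺`-piece iff every monomial `z^a w^e` of its support has `|a| = e + 1`. -/
theorem inJplus_iff_support (f : Fock.HarmModel) :
    Fock.InJplus f ↔ ∀ m ∈ f.support, m (Sum.inl 0) + m (Sum.inl 1) = m (Sum.inr ()) + 1 := by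
  refine ⟨fun h m hm => Fock.inJplus_support h hm, fun h => ?_⟩
  unfold Fock.InJplus
  rw [f.as_sum, map_sum]
  refine Finset.sum_congr rfl (fun m hm => ?_)
  rw [Fock.weightOp_monomial, wt_uWt_eq]
  have h1 : ((m (Sum.inl 0) : ℤ) + m (Sum.inl 1) - m (Sum.inr ()) : ℤ) = 1 := by
    have := h m hm
    omega
  rw [h1]
  simp

/-- `f` lies in the `J⁺`-piece iff it is weighted homogeneous of `uWt`-weight `1`. -/
theorem inJplus_iff_isWeightedHomogeneous (f : Fock.HarmModel) :
    Fock.InJplus f ↔ IsWeightedHomogeneous Fock.uWt f 1 := by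
  rw [inJplus_iff_support]
  refine ⟨fun h => ?_, fun h m hm => ?_⟩
  · intro d hd
    rw [weight_uWt_eq]
    have := h d (mem_support_iff.mpr hd)
    omega
  · have := h (mem_support_iff.mp hm)
    rw [weight_uWt_eq] at this
    omega

/-! ## `K`-stability of the `J⁺`-piece -/

/-- The substituted variables are weighted homogeneous of the weight of the variable. -/
theorem isWeightedHomogeneous_substVar (k : K) (v : Fock.HarmVar) :
    IsWeightedHomogeneous Fock.uWt (substVar k v) (Fock.uWt v) := by
  cases v with
  | inl a =>
    show IsWeightedHomogeneous Fock.uWt (∑ b : Fin 2, (mat k) b a • X (Sum.inl b)) (Fock.uWt (Sum.inl a))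
    refine IsWeightedHomogeneous.sum _ _ _ (fun b _ => ?_)
    rw [smul_eq_C_mul]
    exact (isWeightedHomogeneous_X ℂ Fock.uWt (Sum.inl b)).C_mul _
  | inr u =>
    show IsWeightedHomogeneous Fock.uWt (star (k.2 : ℂ) • X (Sum.inr u)) (Fock.uWt (Sum.inr u))
    rw [smul_eq_C_mul]
    exact (isWeightedHomogeneous_X ℂ Fock.uWt (Sum.inr u)).C_mul _

/-- The substitution `substHom k` preserves weighted homogeneity of every `uWt`-weight. -/
theorem isWeightedHomogeneous_substHom (k : K) {f : Fock.HarmModel} {n : ℤ}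
    (hf : IsWeightedHomogeneous Fock.uWt f n) : IsWeightedHomogeneous Fock.uWt (substHom k f) n := by
  rw [f.as_sum, map_sum]
  refine IsWeightedHomogeneous.sum _ _ _ (fun d hd => ?_)
  have hn : Finsupp.weight Fock.uWt d = n := hf (mem_support_iff.mp hd)
  rw [substHom, aeval_monomial, ← hn, MvPolynomial.algebraMap_eq, Finsupp.weight_apply, Finsupp.sum,
    Finsupp.prod]
  refine IsWeightedHomogeneous.C_mul ?_ _
  refine IsWeightedHomogeneous.prod _ _ _ (fun v _ => ?_)
  exact (isWeightedHomogeneous_substVar k v).pow (d v)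

/-- **The `J⁺`-piece is `K`-stable.** -/
theorem inJplus_fockRep (k : K) {f : Fock.HarmModel} (hf : Fock.InJplus f) : Fock.InJplus (fockRep k f) := by
  rw [inJplus_iff_isWeightedHomogeneous] at hf ⊢
  rw [fockRep_apply, smul_eq_C_mul]
  exact (isWeightedHomogeneous_substHom k hf).C_mul _

/-- The `J⁺`-piece as a submodule: the kernel of `weightOp uWt − 1`. -/
def jplusSubmodule : Submodule ℂ Fock.HarmModel := LinearMap.ker (Fock.weightOp Fock.uWt - LinearMap.id)

/-- (Ported verbatim from the HodgeCMPerL package; no docstring in the source.) -/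
theorem mem_jplusSubmodule {f : Fock.HarmModel} : f ∈ jplusSubmodule ↔ Fock.InJplus f := by
  rw [jplusSubmodule, LinearMap.mem_ker, LinearMap.sub_apply, LinearMap.id_apply, sub_eq_zero]
  rfl

/-- **The `J⁺`-piece as a `K`-subrepresentation of the Fock model.** -/
def jplusSub : Subrepresentation fockRep where
  toSubmodule := jplusSubmodule
  apply_mem_toSubmodule k f hf := by
    rw [mem_jplusSubmodule] at hf ⊢
    exact inJplus_fockRep k hf

/-- `J⁺|_K`: the `K = U(2) × U(1)`-representation on the `J⁺`-piece of the Fock model. -/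
def Jplus : Representation ℂ K jplusSubmodule := jplusSub.toRepresentation

/-- (Ported verbatim from the HodgeCMPerL package; no docstring in the source.) -/
@[simp] theorem Jplus_apply_coe (k : K) (f : jplusSubmodule) : ((Jplus k f : jplusSubmodule) : Fock.HarmModel) = fockRep k f :=
  rfl

/-! ## The exclusions in the input shape `N ↪ J⁺ ⊗ (multiplicity space)` -/

/-- The inclusion `J⁺ ↪ Fock` as a `ℂ[K]`-linear map. -/
def jplusIncl : Jplus.asModule →ₗ[MonoidAlgebra ℂ K] fockRep.asModule :=
  Representation.IntertwiningMap.equivLinearMapAsModule Jplus fockRep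
    (jplusSubmodule.subtype.intertwiningMap_of_isIntertwiningMap Jplus fockRep (fun _ _ => rfl))

/-- (Ported verbatim from the HodgeCMPerL package; no docstring in the source.) -/
theorem jplusIncl_apply (f : Jplus.asModule) : jplusIncl f = (show jplusSubmodule from f).1 := rfl

/-- (Ported verbatim from the HodgeCMPerL package; no docstring in the source.) -/
theorem jplusIncl_injective : Function.Injective jplusIncl := fun f g h =>
  Subtype.ext (show (show jplusSubmodule from f).1 = (show jplusSubmodule from g).1 from h)

section Exclusions

variable {N : Type*} [AddCommGroup N] [Module (MonoidAlgebra ℂ K) N] {ι : Type*}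

/-- Composition with the inclusion: `(ι → J⁺) ↪ (ι → Fock)`, `ℂ[K]`-linearly. -/
def toFock (j : N →ₗ[MonoidAlgebra ℂ K] (ι → Jplus.asModule)) : N →ₗ[MonoidAlgebra ℂ K] (ι → fockRep.asModule) :=
  (jplusIncl.compLeft ι).comp j

/-- (Ported verbatim from the HodgeCMPerL package; no docstring in the source.) -/
theorem toFock_apply (j : N →ₗ[MonoidAlgebra ℂ K] (ι → Jplus.asModule)) (n : N) (i : ι) :
    toFock j n i = jplusIncl (j n i) := rfl

/-- (Ported verbatim from the HodgeCMPerL package; no docstring in the source.) -/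
theorem toFock_injective {j : N →ₗ[MonoidAlgebra ℂ K] (ι → Jplus.asModule)} (hj : Function.Injective j) :
    Function.Injective (toFock j) := by
  intro n n' h
  apply hj
  funext i
  exact jplusIncl_injective (congrFun h i)

/-- (Ported verbatim from the HodgeCMPerL package; no docstring in the source.) -/
theorem toFock_inJplus (j : N →ₗ[MonoidAlgebra ℂ K] (ι → Jplus.asModule)) (n : N) (i : ι) :
    Fock.InJplus (toFock j n i) :=
  mem_jplusSubmodule.mp (show jplusSubmodule from j n i).2

/-- **Neither `F_{0,0}` nor `F_{1,1}` occurs in a `K`-module embedding into copies of `J⁺|_K`.** -/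
theorem noEmbedding_of_Jplus (j : N →ₗ[MonoidAlgebra ℂ K] (ι → Jplus.asModule)) (hj : Function.Injective j) :
    NoEmbedding (MonoidAlgebra ℂ K) F00.asModule N ∧ NoEmbedding (MonoidAlgebra ℂ K) F11.asModule N :=
  ⟨noEmbedding_F00_of_jplus (toFock j) (toFock_injective hj) (toFock_inJplus j),
    noEmbedding_F11_of_fock (toFock j) (toFock_injective hj)⟩

/-- **X1 bridge for `K_{ι₁} = U(2) × U(1)`, leaves from `J⁺|_K`.**  As `thetaPKilledByPminus_of_U2_fock`, with the
embedding datum in the shape "the `(𝔤,K)`-module `N` of `Θ_i(χ'_i)` embeds `K`-equivariantly into a sum of copies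
of `J⁺`" (INPUT N31 ∘ Fock dictionary (F1)/(F2)/(F5) ∘ Howe (r1), see `P43_KTypesFock`). -/
theorem thetaPKilledByPminus_of_U2_Jplus {Ginf Gc Gf V S : Type*} [Group Gc] [Group Gf] [AddCommGroup V]
    [Module ℂ V] [AddCommGroup S] [Module ℂ S]
    (D : P43Forms.FormsDictionary Ginf V) (M : P43Forms.ThetaKernelData Ginf Gc Gf V S)
    {Q : Type*} [AddCommGroup Q] [Module ℂ Q] (σ : Representation ℂ K Q)
    (hQ : generatedBy (MonoidAlgebra ℂ K) pPlus.asModule σ.asModule = ⊤)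
    (j : N →ₗ[MonoidAlgebra ℂ K] (ι → Jplus.asModule)) (hj : Function.Injective j)
    (act : (pMinus.tprod σ).asModule →ₗ[MonoidAlgebra ℂ K] N) (ι' : N →+ (Ginf → V))
    (hdict : ∀ X ∈ D.Pminus, ∀ φ ∈ M.Ptype, ∃ p : (pMinus.tprod σ).asModule,
      X (P43Forms.uEval (M.theta φ)) = ι' (act p))
    (hCoch : ∀ φ ∈ M.Ptype, P43Forms.uEval (M.theta φ) ∈ D.Cochain) :
    P43Forms.ThetaPKilledByPminus D M :=
  thetaPKilledByPminus_of_U2 D M σ hQ (noEmbedding_of_Jplus j hj).1 (noEmbedding_of_Jplus j hj).2 act ι' hdict hCoch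

end Exclusions

/-! ## Convention lock: `𝔭₊ ↪ J⁺` onto the harmonic plane -/

/-- The harmonic plane `ℂz₁ ⊕ ℂz₂ ⊂ ℂ[z₁,z₂,w]`, parametrised by `ℂ²`: `v ↦ v₁ z₁ + v₂ z₂`. -/
def zLin : (Fin 2 → ℂ) →ₗ[ℂ] Fock.HarmModel where
  toFun v := ∑ a : Fin 2, v a • X (Sum.inl a)
  map_add' v w := by
    simp only [Pi.add_apply, add_smul, Finset.sum_add_distrib]
  map_smul' c v := by
    simp only [Pi.smul_apply, smul_eq_mul, mul_smul, Finset.smul_sum, RingHom.id_apply]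

/-- (Ported verbatim from the HodgeCMPerL package; no docstring in the source.) -/
theorem zLin_apply (v : Fin 2 → ℂ) : zLin v = ∑ a : Fin 2, v a • X (Sum.inl a) := rfl

/-- (Ported verbatim from the HodgeCMPerL package; no docstring in the source.) -/
theorem coeff_zLin (v : Fin 2 → ℂ) (a : Fin 2) : coeff (Finsupp.single (Sum.inl a) 1) (zLin v) = v a := by
  rw [zLin_apply, coeff_sum, Fin.sum_univ_two]
  simp only [coeff_smul, coeff_X, smul_eq_mul]
  fin_cases a <;> simp [Finsupp.single_eq_single_iff]

/-- (Ported verbatim from the HodgeCMPerL package; no docstring in the source.) -/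
theorem zLin_injective : Function.Injective zLin := by
  intro v w h
  funext a
  have := congrArg (coeff (Finsupp.single (Sum.inl a) 1)) h
  rwa [coeff_zLin, coeff_zLin] at this

/-- `K`-equivariance of `v ↦ v₁ z₁ + v₂ z₂` for `pPlus` (`(A,d)·v = d̄ A v`) and `fockRep` (`z_a ↦ d̄ Σ_b A_{ba} z_b`). -/
theorem zLin_equivariant (k : K) (v : Fin 2 → ℂ) : zLin (pPlus k v) = fockRep k (zLin v) := by
  rw [pPlus_apply, fockRep_apply, map_smul, zLin_apply, zLin_apply, map_sum]
  simp only [map_smul, substHom_X, substVar, Matrix.mulVec, dotProduct, Fin.sum_univ_two, smul_add]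
  module

/-- The image of the harmonic plane lies in the `J⁺`-piece (`|a| = 1 = e + 1` with `e = 0`). -/
theorem zLin_mem_jplus (v : Fin 2 → ℂ) : zLin v ∈ jplusSubmodule := by
  rw [zLin_apply]
  refine Submodule.sum_mem _ (fun a _ => Submodule.smul_mem _ _ ?_)
  rw [mem_jplusSubmodule]
  have hX : (X (Sum.inl a) : Fock.HarmModel) = monomial (Finsupp.single (Sum.inl a) 1) 1 := rfl
  rw [hX]
  refine Fock.monomial_inJplus _ ?_ 1
  fin_cases a <;> simp

/-- **`𝔭₊ ↪ J⁺|_K`**: the harmonic plane as an injective `K`-intertwiner `pPlus → Jplus`. -/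
def zEmb : Representation.IntertwiningMap pPlus Jplus :=
  (LinearMap.codRestrict jplusSubmodule zLin zLin_mem_jplus).intertwiningMap_of_isIntertwiningMap pPlus Jplus
    (fun k v => Subtype.ext (zLin_equivariant k v))

/-- (Ported verbatim from the HodgeCMPerL package; no docstring in the source.) -/
theorem zEmb_apply_coe (v : Fin 2 → ℂ) : ((zEmb.toLinearMap v : jplusSubmodule) : Fock.HarmModel) = zLin v := rfl

/-- (Ported verbatim from the HodgeCMPerL package; no docstring in the source.) -/
theorem zEmb_injective : Function.Injective zEmb.toLinearMap := fun v w h =>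
  zLin_injective ((zEmb_apply_coe v).symm.trans ((congrArg (fun x : jplusSubmodule => (x : Fock.HarmModel)) h).trans
    (zEmb_apply_coe w)))

/-- **CONVENTION LOCK.**  The abstract `𝔭₊` of `P43_KTypesU2Gen` occurs in `J⁺|_K` of the Fock model: there is an
injective `K`-intertwiner `pPlus → Jplus` (onto `ℂz₁ ⊕ ℂz₂`, the lowest `K`-type, pv12 `Fock.jplus_lowest`). -/
theorem pPlus_embeds_Jplus : ∃ T : Representation.IntertwiningMap pPlus Jplus, Function.Injective T.toLinearMap :=
  ⟨zEmb, zEmb_injective⟩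

end P43KTypesU2
end PerL34
end HodgeCM

end
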